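import Mathlib
import Summits.MatrixMultiplication.MatrixMultiplication.Theorems.HiddenToeplitzCornersHiddenCornerLemmaRRankOnePencil
import Summits.MatrixMultiplication.MatrixMultiplication.Theorems.HiddenToeplitzCornersHiddenCornerLemmaRHConst
import Summits.MatrixMultiplication.MatrixMultiplication.Theorems.HiddenToeplitzCornersHiddenCornerLemmaRRankTwoReduction
import Summits.MatrixMultiplication.MatrixMultiplication.Theorems.HiddenToeplitzCornersHiddenCornerLemmaRRankTwoSpacesColumn

/-!
# The compression reduction of the hidden-corner lemma for `d ≤ 2`, small classes only

Support file for crux item `stmt-MatrixMultiplication-10752`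
(`Summit.MatrixMultiplication.MatrixMultiplication.Theses.HiddenToeplitzCorners.HiddenCornerLemmaR`),
line `frobenius-dual-short-syzygies`, stub `stub_compressionReduction`; refines the landed
`hclR_reduction_d_le_two` (file `…RankTwoReduction.lean`).

* `hclR_image_branch`: the class-`(2,0)` branch of a rank-two pencil (some `B Π` of rank two forces
  every member to have image in `im A`), extracted from the landed `hclR_rank_two_split_of_rank_two`.
* `hclR_rank_two_split_small` / `hclR_rank_le_two_pencil_split_small`: a pencil of complex matrices of
  rank `≤ d ≤ 2` lies in a `(p,q)`-compression class `D i = G₀ (H₁ i)ᵀ + (G₁ i) H₀ᵀ` with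
  EITHER `p + q ≤ d` (classes `(0,0)`, `(1,0)`, `(0,1)`, `(2,0)`, `(1,1)`, `(0,2)`) OR `p = 0`
  (the H-constant class `(0,3)`, which absorbs the primitive `Alt₃` core); always `2p + q ≤ 2d`.
  Compared with `hclR_rank_le_two_pencil_split` the column branch `(1,2)` is sharpened to
  `(2,0) ∨ (1,1) ∨ (0,2)` by `hclR_column_branch`.
* `hclR_disp_split_small`: the same for the coefficientwise Stein displacements of a pencil with
  `rank (T(X) − Z T(X) Zᵀ) ≤ d ≤ 2`.
* `hclR_reduction_small_classes`: for `d ≤ 2`, the class inequality `r ≤ 2p + q` demanded ONLY for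
  the classes with `p + q ≤ d` implies the hidden-corner lemma at displacement rank `d`; the
  H-constant classes `(0,q)` are discharged internally by the landed `hclR_hconst_bound` (`r ≤ q`).
  So `HiddenCornerLemmaR` at `d ≤ 1` needs the law for `(1,0)`, `(0,1)` only, and at `d = 2` for
  `(2,0)`, `(1,1)`, `(0,2)`, `(1,0)`, `(0,1)` only.
-/

set_option linter.dupNamespace false

namespace Summit.MatrixMultiplication.MatrixMultiplication.Theorems

open Matrix

variable {m n : Type*} [Fintype m] [Fintype n]

/-! ## The image branch (class `(2,0)`) -/

/-- **Image branch.** Let `A` have the frame `(U, Ψ, Y)`, let all members `Σ c • D` and `A ± Σ c • D`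
have rank `≤ 2`, and suppose some member `B` has `rank (B Π) ≥ 2` for the kernel projection
`Π = 1 - Y Ψ A`.  Then every `D i` has image in `im A`: `(1 - U Ψ) D i = 0`.  (Extracted from the
landed `hclR_rank_two_split_of_rank_two`: `X := Π R Ψ A` with `Ψ B Π R = 1` has `A X = 0`, `B X = A`,
and (P2), polarised, applies.) -/
theorem hclR_image_branch [DecidableEq m] [DecidableEq n] {ι : Type*} [Fintype ι] [DecidableEq ι]
    (D : ι → Matrix m n ℂ) {A : Matrix m n ℂ} {U : Matrix m (Fin 2) ℂ} {Ψ : Matrix (Fin 2) m ℂ}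
    {Y : Matrix n (Fin 2) ℂ} (hΨU : Ψ * U = 1) (hAY : A * Y = U) (hUΨA : U * (Ψ * A) = A)
    (hrk : ∀ c : ι → ℂ, (∑ i, c i • D i).rank ≤ 2 ∧ (A + ∑ i, c i • D i).rank ≤ 2 ∧
      (A - ∑ i, c i • D i).rank ≤ 2)
    (c₁ : ι → ℂ) (hc₁ : 2 ≤ ((∑ i, c₁ i • D i) * (1 - Y * (Ψ * A))).rank) :
    ∀ i, (1 - U * Ψ) * D i = 0 := by
  have hDi : ∀ i, ∑ j, (Pi.single i (1 : ℂ) : ι → ℂ) j • D j = D i := by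
    intro i
    simp [Pi.single_apply, ite_smul, Finset.sum_ite_eq']
  set P : Matrix n n ℂ := 1 - Y * (Ψ * A) with hPdef
  clear_value P
  set B := ∑ i, c₁ i • D i with hBdef
  clear_value B
  obtain ⟨hB, hApB, hAmB⟩ := hrk c₁
  rw [← hBdef] at hB hApB hAmB
  have hP1B := hclR_P1_matrix hΨU hAY hUΨA hB hApB hAmB
  rw [← hPdef] at hP1B
  have hrank2 : 2 ≤ (Ψ * (B * P)).rank := by
    have := Matrix.rank_mul_le_right U (Ψ * (B * P))
    rw [← hP1B] at this
    omega
  obtain ⟨R, hR⟩ := hclR_rightInverse_of_rank (Ψ * (B * P)) hrank2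
  set X := P * (R * (Ψ * A)) with hXdef
  clear_value X
  have hAP : A * P = 0 := by
    rw [hPdef]
    exact hclR_frame_mul_proj hAY hUΨA
  have hAX : A * X = 0 := by
    rw [hXdef, ← Matrix.mul_assoc, hAP, Matrix.zero_mul]
  have hBX : B * X = A := by
    rw [hXdef, ← Matrix.mul_assoc, hP1B, Matrix.mul_assoc U, ← Matrix.mul_assoc (Ψ * (B * P)), hR,
      Matrix.one_mul, hUΨA]
  have hBim : (1 - U * Ψ) * B = 0 := by
    have := hclR_P2_matrix hΨU hAY hUΨA hB hApB hAmB (Xm := X) (Ym := 1) hAX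
      (by rw [Matrix.mul_one, hBX])
    rwa [Matrix.mul_one] at this
  intro i
  obtain ⟨hD, hApD, hAmD⟩ := hrk (Pi.single i 1)
  rw [hDi i] at hD hApD hAmD
  obtain ⟨hBD, hApBD, hAmBD⟩ := hrk (c₁ + Pi.single i 1)
  have hsum : ∑ j, (c₁ + Pi.single i 1 : ι → ℂ) j • D j = B + D i := by
    simp only [Pi.add_apply, add_smul, Finset.sum_add_distrib, hDi i, hBdef]
  rw [hsum] at hBD hApBD hAmBD
  have hP1D := hclR_P1_matrix hΨU hAY hUΨA hD hApD hAmD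
  rw [← hPdef] at hP1D
  have hDX : D i * X = U * (Ψ * (D i * X)) := by
    have e : D i * X = U * (Ψ * (D i * P)) * (R * (Ψ * A)) := by
      conv_lhs => rw [hXdef, ← Matrix.mul_assoc (D i), hP1D]
    rw [e]
    simp only [Matrix.mul_assoc]
    rw [← Matrix.mul_assoc Ψ U, hΨU, Matrix.one_mul]
  have h2 : (1 - U * Ψ) * (D i * (Y * (Ψ * (D i * X)))) = 0 := by
    refine hclR_P2_matrix hΨU hAY hUΨA hD hApD hAmD hAX ?_
    rw [← Matrix.mul_assoc, hAY, ← hDX]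
  have h3 : (1 - U * Ψ) * ((B + D i) * (1 + Y * (Ψ * (D i * X)))) = 0 := by
    refine hclR_P2_matrix hΨU hAY hUΨA hBD hApBD hAmBD hAX ?_
    rw [Matrix.mul_add, Matrix.mul_one, ← Matrix.mul_assoc A Y, hAY, ← hDX, Matrix.add_mul, hBX]
  have e : (1 - U * Ψ) * ((B + D i) * (1 + Y * (Ψ * (D i * X)))) =
      (1 - U * Ψ) * B * (1 + Y * (Ψ * (D i * X))) + (1 - U * Ψ) * D i +
        (1 - U * Ψ) * (D i * (Y * (Ψ * (D i * X)))) := by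
    simp only [Matrix.mul_add, Matrix.add_mul, Matrix.mul_one, Matrix.mul_assoc]
    abel
  rw [e, hBim, Matrix.zero_mul, zero_add, h2, add_zero] at h3
  exact h3

/-! ## The refined split -/

/-- **Refined rank-two split.** If all combinations of `D` have rank `≤ 2` and some combination has
rank `2`, then `D` is of class `(2,0)`, `(1,1)`, `(0,2)` (so `p + q ≤ 2`) or `(0,3)` (`p = 0`). -/
theorem hclR_rank_two_split_small [DecidableEq m] [DecidableEq n] {ι : Type*} [Fintype ι]
    [DecidableEq ι] (D : ι → Matrix m n ℂ) (h : ∀ c : ι → ℂ, (∑ i, c i • D i).rank ≤ 2)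
    (c₀ : ι → ℂ) (hA : (∑ i, c₀ i • D i).rank = 2) :
    ∃ (p q : ℕ) (G₀ : Matrix m (Fin p) ℂ) (H₀ : Matrix n (Fin q) ℂ)
      (H₁ : ι → Matrix n (Fin p) ℂ) (G₁ : ι → Matrix m (Fin q) ℂ),
      (p + q ≤ 2 ∨ p = 0) ∧ 2 * p + q ≤ 4 ∧ ∀ i, D i = G₀ * (H₁ i)ᵀ + G₁ i * H₀ᵀ := by
  set A := ∑ i, c₀ i • D i with hAdef
  clear_value A
  obtain ⟨U, Ψ, Y, hΨU, hAY, hUΨA⟩ := hclR_frame_exists A hA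
  have hrk : ∀ c : ι → ℂ, (∑ i, c i • D i).rank ≤ 2 ∧ (A + ∑ i, c i • D i).rank ≤ 2 ∧
      (A - ∑ i, c i • D i).rank ≤ 2 := by
    intro c
    refine ⟨h c, ?_, ?_⟩
    · have : A + ∑ i, c i • D i = ∑ i, (c₀ + c) i • D i := by
        simp only [hAdef, Pi.add_apply, add_smul, Finset.sum_add_distrib]
      rw [this]
      exact h _
    · have : A - ∑ i, c i • D i = ∑ i, (c₀ - c) i • D i := by
        simp only [hAdef, Pi.sub_apply, sub_smul, Finset.sum_sub_distrib]
      rw [this]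
      exact h _
  have hDi : ∀ i, ∑ j, (Pi.single i (1 : ℂ) : ι → ℂ) j • D j = D i := by
    intro i
    simp [Pi.single_apply, ite_smul, Finset.sum_ite_eq']
  have hdecomp : ∀ i, D i = D i * (1 - Y * (Ψ * A)) + D i * Y * (Ψ * A) := by
    intro i
    rw [Matrix.mul_sub, Matrix.mul_one, Matrix.mul_assoc, sub_add_cancel]
  -- the class-(2,0) packaging, for any frame
  have pack20 : ∀ (U' : Matrix m (Fin 2) ℂ) (Ψ' : Matrix (Fin 2) m ℂ),
      (∀ i, (1 - U' * Ψ') * D i = 0) →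
      ∃ (p q : ℕ) (G₀ : Matrix m (Fin p) ℂ) (H₀ : Matrix n (Fin q) ℂ)
        (H₁ : ι → Matrix n (Fin p) ℂ) (G₁ : ι → Matrix m (Fin q) ℂ),
        (p + q ≤ 2 ∨ p = 0) ∧ 2 * p + q ≤ 4 ∧ ∀ i, D i = G₀ * (H₁ i)ᵀ + G₁ i * H₀ᵀ := by
    intro U' Ψ' himg
    refine ⟨2, 0, U', 0, fun i => (Ψ' * D i)ᵀ, fun _ => 0, Or.inl (by norm_num), by norm_num,
      fun i => ?_⟩
    rw [Matrix.transpose_transpose, Matrix.zero_mul, add_zero]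
    have := himg i
    rw [Matrix.sub_mul, Matrix.one_mul, sub_eq_zero] at this
    rw [← Matrix.mul_assoc]
    exact this
  by_cases hcase : ∀ c : ι → ℂ, (∑ i, c i • (D i * (1 - Y * (Ψ * A)))).rank ≤ 1
  · rcases hclR_rank_le_one_pencil_dichotomy (fun i => D i * (1 - Y * (Ψ * A))) hcase with
      ⟨u, hu⟩ | ⟨v, hv⟩
    · -- column type
      choose v hv using hu
      by_cases hv0 : ∀ i, D i * (1 - Y * (Ψ * A)) = 0
      · -- class (0,2)
        refine ⟨0, 2, 0, (Ψ * A)ᵀ, fun _ => 0, fun i => D i * Y, Or.inr rfl, by norm_num,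
          fun i => ?_⟩
        rw [Matrix.transpose_transpose, Matrix.zero_mul, zero_add]
        conv_lhs => rw [hdecomp i, hv0 i, zero_add]
      · push Not at hv0
        obtain ⟨i₀, hi₀⟩ := hv0
        have hu0 : u ≠ 0 := by
          rintro rfl
          exact hi₀ (by rw [hv i₀, Matrix.zero_vecMulVec])
        have hvi₀ : v i₀ ≠ 0 := by
          intro h0
          apply hi₀
          rw [hv i₀, h0]
          exact Matrix.ext fun _ _ => mul_zero _
        -- `u ∈ im A`
        obtain ⟨hD, hApD, hAmD⟩ := hrk (Pi.single i₀ 1)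
        rw [hDi i₀] at hD hApD hAmD
        have hP1 := hclR_P1_matrix hΨU hAY hUΨA hD hApD hAmD
        rw [hv i₀, hclR_mul_vecMulVec, hclR_mul_vecMulVec] at hP1
        have hUΨu : U *ᵥ (Ψ *ᵥ u) = u := by
          obtain ⟨k, hk⟩ := Function.ne_iff.mp hvi₀
          ext a
          have := congrFun (congrFun hP1 a) k
          simp only [Matrix.vecMulVec_apply] at this
          exact (mul_right_cancel₀ hk this).symm
        obtain ⟨U', Ψ', Y', hΨU', hAY', hUΨA', hP', hu'⟩ :=
          hclR_frame_change hΨU hAY hUΨA hUΨu hu0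
        have hv' : ∀ i, D i * (1 - Y' * (Ψ' * A)) = Matrix.vecMulVec (fun a => U' a 0) (v i) := by
          intro i
          rw [hP', hu']
          exact hv i
        rcases hclR_column_branch D hΨU' hAY' hUΨA' hrk v hv' i₀ hvi₀ with himg | h11
        · exact pack20 U' Ψ' himg
        · -- class (1,1)
          refine ⟨1, 1, Matrix.of fun a _ => U' a 0, Matrix.of fun k _ => (Ψ' * A) 1 k,
            fun i => Matrix.of fun k _ =>
              (v i + (Ψ' 0 ⬝ᵥ (D i *ᵥ fun k => Y' k 0)) • (Ψ' * A) 0) k,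
            fun i => Matrix.of fun a _ => (D i *ᵥ fun k => Y' k 1) a, Or.inl (by norm_num),
            by norm_num, fun i => ?_⟩
          conv_lhs => rw [h11 i]
          ext a k
          simp [Matrix.mul_apply, Matrix.vecMulVec_apply, Matrix.add_apply]
    · -- row type: class (0, 3)
      choose u hu using hv
      refine ⟨0, 3, 0, Matrix.of fun k l => ![v k, (Ψ * A) 0 k, (Ψ * A) 1 k] l, fun _ => 0,
        fun i => Matrix.of fun a l => ![u i a, (D i * Y) a 0, (D i * Y) a 1] l, Or.inr rfl,
        by norm_num, fun i => ?_⟩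
      conv_lhs => rw [hdecomp i, hu i]
      ext a k
      simp only [Matrix.add_apply, Matrix.vecMulVec_apply, Matrix.mul_apply, Fin.sum_univ_three,
        Fin.sum_univ_two, Matrix.zero_mul, Matrix.zero_apply, Matrix.of_apply,
        Matrix.transpose_apply, Matrix.cons_val_zero, Matrix.cons_val_one, Matrix.cons_val_two,
        Matrix.head_cons, Matrix.tail_cons, zero_add]
      ring
  · -- image branch: class (2,0)
    push Not at hcase
    obtain ⟨c₁, hc₁⟩ := hcase
    have hBP : ∑ i, c₁ i • (D i * (1 - Y * (Ψ * A))) = (∑ i, c₁ i • D i) * (1 - Y * (Ψ * A)) := by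
      rw [Matrix.sum_mul]
      simp only [Matrix.smul_mul]
    rw [hBP] at hc₁
    exact pack20 U Ψ (hclR_image_branch D hΨU hAY hUΨA hrk c₁ hc₁)

/-- **Refined split, `d ≤ 2`.** A pencil of complex matrices of rank `≤ d ≤ 2` lies in a
`(p,q)`-compression class with (`p + q ≤ d` or `p = 0`) and `2p + q ≤ 2d`. -/
theorem hclR_rank_le_two_pencil_split_small [DecidableEq m] [DecidableEq n] {ι : Type*} [Fintype ι]
    [DecidableEq ι] (D : ι → Matrix m n ℂ) (d : ℕ) (hd : d ≤ 2)
    (h : ∀ c : ι → ℂ, (∑ i, c i • D i).rank ≤ d) :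
    ∃ (p q : ℕ) (G₀ : Matrix m (Fin p) ℂ) (H₀ : Matrix n (Fin q) ℂ)
      (H₁ : ι → Matrix n (Fin p) ℂ) (G₁ : ι → Matrix m (Fin q) ℂ),
      (p + q ≤ d ∨ p = 0) ∧ 2 * p + q ≤ 2 * d ∧ ∀ i, D i = G₀ * (H₁ i)ᵀ + G₁ i * H₀ᵀ := by
  have hDi : ∀ i, ∑ j, (Pi.single i (1 : ℂ) : ι → ℂ) j • D j = D i := by
    intro i
    simp [Pi.single_apply, ite_smul, Finset.sum_ite_eq']
  by_cases h0 : ∀ i, D i = 0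
  · exact ⟨0, 0, 0, 0, fun _ => 0, fun _ => 0, Or.inr rfl, by omega, fun i => by simp [h0 i]⟩
  push Not at h0
  obtain ⟨i₀, hi₀⟩ := h0
  have hd1 : 1 ≤ d := by
    by_contra hlt
    have : (D i₀).rank = 0 := by
      have := h (Pi.single i₀ 1)
      rw [hDi] at this
      omega
    exact hi₀ (hclR_eq_zero_of_rank_eq_zero _ this)
  by_cases h1 : ∀ c : ι → ℂ, (∑ i, c i • D i).rank ≤ 1
  · rcases hclR_rank_le_one_pencil_dichotomy D h1 with ⟨u, hu⟩ | ⟨v, hv⟩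
    · choose v hv using hu
      refine ⟨1, 0, Matrix.of fun a _ => u a, 0, fun i => Matrix.of fun k _ => v i k, fun _ => 0,
        Or.inl (by omega), by omega, fun i => ?_⟩
      rw [hv i]
      ext a k
      simp [Matrix.mul_apply, Matrix.vecMulVec_apply]
    · choose u hu using hv
      refine ⟨0, 1, 0, Matrix.of fun k _ => v k, fun _ => 0, fun i => Matrix.of fun a _ => u i a,
        Or.inr rfl, by omega, fun i => ?_⟩
      rw [hu i]
      ext a k
      simp [Matrix.mul_apply, Matrix.vecMulVec_apply]
  · push Not at h1
    obtain ⟨c₀, hc₀⟩ := h1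
    have hd2 : d = 2 := by
      have := h c₀
      omega
    subst hd2
    have hA : (∑ i, c₀ i • D i).rank = 2 := le_antisymm (h c₀) hc₀
    exact hclR_rank_two_split_small D h c₀ hA

/-! ## The reduction for `d ≤ 2` with the small classes only -/

/-- **The displacement pencil of a pencil with `d ≤ 2` splits into a small class.**  If every
`T(X) − Z T(X) Zᵀ` has rank `≤ d ≤ 2`, the coefficientwise displacements split as
`G₀ (H₁ a b)ᵀ + (G₁ a b) H₀ᵀ` with constant `G₀ : N × p`, `H₀ : N × q`, where `p + q ≤ d` or
`p = 0`, and `2p + q ≤ 2d`. -/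
theorem hclR_disp_split_small (r N d : ℕ) (T : Fin r → Fin r → Matrix (Fin N) (Fin N) ℂ)
    (hd : d ≤ 2)
    (hdisp : ∀ X : Matrix (Fin r) (Fin r) ℂ, ((∑ a : Fin r, ∑ b : Fin r, X a b • T a b) -
        (Matrix.of fun i j : Fin N => if (i : ℕ) = (j : ℕ) + 1 then (1 : ℂ) else 0) *
        (∑ a : Fin r, ∑ b : Fin r, X a b • T a b) *
        (Matrix.of fun i j : Fin N => if (i : ℕ) = (j : ℕ) + 1 then (1 : ℂ) else 0)ᵀ).rank ≤ d) :
    ∃ (p q : ℕ) (G₀ : Matrix (Fin N) (Fin p) ℂ) (H₀ : Matrix (Fin N) (Fin q) ℂ)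
      (H₁ : Fin r → Fin r → Matrix (Fin N) (Fin p) ℂ) (G₁ : Fin r → Fin r → Matrix (Fin N) (Fin q) ℂ),
      (p + q ≤ d ∨ p = 0) ∧ 2 * p + q ≤ 2 * d ∧
      ∀ a b, T a b - (Matrix.of fun i j : Fin N => if (i : ℕ) = (j : ℕ) + 1 then (1 : ℂ) else 0) *
          T a b * (Matrix.of fun i j : Fin N => if (i : ℕ) = (j : ℕ) + 1 then (1 : ℂ) else 0)ᵀ
        = G₀ * (H₁ a b)ᵀ + G₁ a b * H₀ᵀ := by
  set Z := (Matrix.of fun i j : Fin N => if (i : ℕ) = (j : ℕ) + 1 then (1 : ℂ) else 0) with hZ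
  let D : Fin r × Fin r → Matrix (Fin N) (Fin N) ℂ := fun ab => T ab.1 ab.2 - Z * T ab.1 ab.2 * Zᵀ
  have hlin : ∀ c : Fin r × Fin r → ℂ, (∑ i, c i • D i) =
      (∑ a : Fin r, ∑ b : Fin r, (fun a b => c (a, b)) a b • T a b) -
        Z * (∑ a : Fin r, ∑ b : Fin r, (fun a b => c (a, b)) a b • T a b) * Zᵀ := by
    intro c
    simp only [D, smul_sub, Finset.sum_sub_distrib, Finset.mul_sum, Finset.sum_mul, Matrix.mul_smul,
      Matrix.smul_mul]
    rw [← Finset.sum_product' (f := fun a b => c (a, b) • T a b),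
      ← Finset.sum_product' (f := fun a b => c (a, b) • (Z * T a b * Zᵀ))]
    simp [Finset.univ_product_univ]
  have hrank : ∀ c : Fin r × Fin r → ℂ, (∑ i, c i • D i).rank ≤ d := by
    intro c
    rw [hlin c]
    exact hdisp _
  obtain ⟨p, q, G₀, H₀, H₁, G₁, hpq, h2pq, hsplit⟩ := hclR_rank_le_two_pencil_split_small D d hd hrank
  exact ⟨p, q, G₀, H₀, fun a b => H₁ (a, b), fun a b => G₁ (a, b), hpq, h2pq,
    fun a b => hsplit (a, b)⟩

/-- **Compression reduction at `d ≤ 2`, small classes only.**  Let `d ≤ 2`.  If every generically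
nonsingular corner-hiding pencil of compression class `(p,q)` WITH `p + q ≤ d` satisfies
`r ≤ 2p + q`, then every generically nonsingular corner-hiding pencil of displacement rank `≤ d` has
`r ≤ 2d` (the hidden-corner lemma `HiddenCornerLemmaR` at displacement rank `d`).  The H-constant
classes `(0,q)` met on the way (`q ≤ 3`) are discharged by the landed `hclR_hconst_bound`. -/
theorem hclR_reduction_small_classes :
    ∀ (d : ℕ), d ≤ 2 →
    (∀ (r N p q : ℕ) (T : Fin r → Fin r → Matrix (Fin N) (Fin N) ℂ) (E F : Matrix (Fin N) (Fin r) ℂ)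
        (G₀ : Matrix (Fin N) (Fin p) ℂ) (H₀ : Matrix (Fin N) (Fin q) ℂ)
        (H₁ : Fin r → Fin r → Matrix (Fin N) (Fin p) ℂ) (G₁ : Fin r → Fin r → Matrix (Fin N) (Fin q) ℂ),
        p + q ≤ d → E.rank = r → F.rank = r →
        (∀ X : Matrix (Fin r) (Fin r) ℂ, (∑ a : Fin r, ∑ b : Fin r, X a b • T a b) * E = F * X) →
        (∀ a b, T a b - (Matrix.of fun i j : Fin N => if (i : ℕ) = (j : ℕ) + 1 then (1 : ℂ) else 0) * T a b *
            (Matrix.of fun i j : Fin N => if (i : ℕ) = (j : ℕ) + 1 then (1 : ℂ) else 0)ᵀ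
            = G₀ * (H₁ a b)ᵀ + G₁ a b * H₀ᵀ) →
        (∃ X₀ : Matrix (Fin r) (Fin r) ℂ, (∑ a : Fin r, ∑ b : Fin r, X₀ a b • T a b).det ≠ 0) →
        r ≤ 2 * p + q) →
    ∀ (r N : ℕ) (T : Fin r → Fin r → Matrix (Fin N) (Fin N) ℂ) (E F : Matrix (Fin N) (Fin r) ℂ),
      E.rank = r → F.rank = r →
      (∀ X : Matrix (Fin r) (Fin r) ℂ, (∑ a : Fin r, ∑ b : Fin r, X a b • T a b) * E = F * X) →
      (∀ X : Matrix (Fin r) (Fin r) ℂ, ((∑ a : Fin r, ∑ b : Fin r, X a b • T a b) -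
        (Matrix.of fun i j : Fin N => if (i : ℕ) = (j : ℕ) + 1 then (1 : ℂ) else 0) *
        (∑ a : Fin r, ∑ b : Fin r, X a b • T a b) *
        (Matrix.of fun i j : Fin N => if (i : ℕ) = (j : ℕ) + 1 then (1 : ℂ) else 0)ᵀ).rank ≤ d) →
      (∃ X₀ : Matrix (Fin r) (Fin r) ℂ, (∑ a : Fin r, ∑ b : Fin r, X₀ a b • T a b).det ≠ 0) →
      r ≤ 2 * d := by
  intro d hd hclass r N T E F hE hF hcorner hdisp hns
  obtain ⟨p, q, G₀, H₀, H₁, G₁, hpq, h2pq, hsplit⟩ := hclR_disp_split_small r N d T hd hdisp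
  rcases hpq with hpq | hp0
  · have := hclass r N p q T E F G₀ H₀ H₁ G₁ hpq hE hF hcorner hsplit hns
    omega
  · subst hp0
    rcases Nat.eq_zero_or_pos r with hr | hr
    · omega
    have hFne : F ≠ 0 := by
      intro h
      rw [h, Matrix.rank_zero] at hF
      omega
    have hdisp' : ∀ a b, T a b - (Matrix.of fun i j : Fin N => if (i : ℕ) = (j : ℕ) + 1 then (1 : ℂ) else 0) *
        T a b * (Matrix.of fun i j : Fin N => if (i : ℕ) = (j : ℕ) + 1 then (1 : ℂ) else 0)ᵀ
        = G₁ a b * H₀ᵀ := by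
      intro a b
      rw [hsplit a b]
      have h0 : G₀ * (H₁ a b)ᵀ = 0 := by
        ext i j
        simp [Matrix.mul_apply]
      rw [h0, zero_add]
    have := hclR_hconst_bound r N q T E F H₀ G₁ hFne hcorner hdisp'
    omega

end Summit.MatrixMultiplication.MatrixMultiplication.Theorems
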